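/-
COR-CM (cell pub-hodgecm2, stage 2 of the Hodge ladder) — junction B01 `PerLFace_of_PerL`: the displayed leaf B01-H
`Universe.HeckeWedge10` (`CorCM/B01/FaceInputsSplit.lean`, p252201) PROVED on the model universe — step (5) of the B01-H closing
chain (RULING B01-H-CHAIN PATHS / WEDGE-PROOF, lead gen 5, 2026-08-21T07:00Z).  AUTHORED by seat b06 gen 19
(prover-pub-hodgecm2-b06-g19-0; lane WEDGE-PROOF; staged bytes `HOME/pub-hodgecm2-b06/wedge/HeckeWedge10Holds.lean`, md5 2bcd0ebb6b01;
kernel-certified in the monolith `Mono3.lean`: farm rc 0 · 0 sorry · `#print axioms Model.heckeWedge10_holds` = trio) over W1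
`UnitaryBallClassLiftTranslate` (b06, p253198 ✔), W2 `UnitaryBallHeckeWedge` (b06, p253524), b10's Hecke pair (`CorCM/B01/HeckePair.lean`,
p253640 ✔) and b28's reduction (`CorCM/B01/HeckeWedgeAnisotropicReduction.lean`, p254213); FILED verbatim (this header replacing the
staging header) by the single owner of B01, prover-pub-hodgecm2-own-b01-0.  Holomorphic case of Clozel 1993 / Venkataramana 2001 Thm 8
PROVED on the model (real approximation + the line-field theorem + the classLift dictionary + Hecke pairs as `U.Mor`); no named fact
consumed; `U.PerL` idle.  Theorems only; nothing asserted.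
-/
import Summits.HodgeConjecture.CorCM.B01.FaceInputsSplit
import Summits.HodgeConjecture.CorCM.B01.HeckePair
import Summits.HodgeConjecture.CorCM.B01.HeckeWedgeAnisotropicReduction
import Literature.AlgebraicGeometry.ShimuraVarieties.UnitaryBallHeckeWedge
import Literature.AlgebraicGeometry.ShimuraVarieties.UnitaryBallRationalImage
import HarnessLib

/-!
# B01-H `HeckeWedge10` holds on the model universe

`Universe.HeckeWedge10 U`: for every CM field `L`, embedding `ι₁`, hermitian 3-space `V`, level `Γ` and two NON-ZERO classes
`a, a' ∈ H^{1,0}(U.pms L ι₁ V Γ)` there are a level `Γ'` and two morphisms `g h : U.pms L ι₁ V Γ' ⟶ U.pms L ι₁ V Γ` with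
`g^* a ∪ h^* a' ≠ 0`.  On the model universe `U = Model.picardCMUniverse hHD hI h₁ h₃` this is a THEOREM:

* off the anisotropic locus of the Picard code the surface is the dummy `ℙ²_ℂ`, `H¹ = 0`, and the leaf is vacuous
  (b28: `Model.picardCMUniverse_heckeWedge10_of_isAnisotropic`);
* on the anisotropic locus `U.pms L ι₁ V Γ` is a genuine compact congruence ball quotient `X_Γ(ℂ) = Γ\𝔹²` (datum
  `Var.ballDatum`, frame `𝔣`).  The image `Δ ≤ U(2,1)` of the rational isometries `U(V₃,h)(L)` along the frame is DENSE
  (real approximation, `BallRational.dense_ratSubgroup`), so the Hecke wedge of the ball quotient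
  (`UnitaryBallUniformisationDatum.exists_mem_forall_cup_pull_ne_zero`: lifts of `(1,0)`-classes to the ball, the line-field
  theorem for dense subgroups, `classLift` transport along Hecke translations, cup `= 0 ⇒` wedge of lifts `≡ 0`) yields a
  rational isometry `γ` such that `T^* a ∪ π^* a' ≠ 0` for the two projections `π` (`[v] ↦ [v]`) and `T = π_γ`
  (`[v] ↦ [γ^{ι₁} v]`) of the Hecke correspondence from the Hecke level `Γ' = Γ ∩ γ⁻¹Γγ` (b10: `Level.heckePair`,
  `Model.exists_mor_pms_heckePair` — both are morphisms of `U`, GAGA).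

Main results: `Model.heckeWedge10_body_of_isAnisotropic` (the body of the leaf at an anisotropic code),
**`Model.heckeWedge10_holds : ∀ hHD hI h₁ h₃, (picardCMUniverse hHD hI h₁ h₃).HeckeWedge10`** (the displayed input B01-H of
`Model.perLFace_of_PerL_of_supply_heckeWedge10_overlap`, discharged), and the re-cut of B01 BY NAME without it:
`Model.perLFace_of_PerL_of_supply_overlap : (∀ data, FaceSupply) → (∀ data, FaceWedgeOverlap) → PerLFace_of_PerL`.

In print this is the holomorphic case of the non-vanishing of cup products of Hecke translates on the congruence tower of
compact ball quotients (Clozel, J. reine angew. Math. 444 (1993); Venkataramana, Compositio Math. 125 (2001) Thm. 8 and Remark)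
— here a kernel theorem of the model, not a record.
-/

noncomputable section

open scoped TensorProduct Matrix
open NumberField CategoryTheory
open Literature.AlgebraicGeometry.Motives
open Literature.AlgebraicGeometry.ShimuraVarieties
open Literature.AlgebraicGeometry.HodgeTheory
open Literature.NumberTheory.Automorphic
open Literature.NumberTheory.Automorphic.PicardCM
open Literature.Geometry.ComplexHyperbolic
open Literature.Geometry.ComplexHyperbolic.BallModel (U21 Ball)

namespace Summit.HodgeConjecture.CorCM.Model

variable (hHD : exists_isReal_hodgeModel) (hI : hodgePQ_independent_of_hodgeModel)
  (h₁ : BallQuotientUniformised) (h₃ : CMAbelianVarietyRealised)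

/-- The Gram matrix of a hermitian 3-space is hermitian in matrix form, for Mathlib's conjugation: `ᵗ(σ Hm) = Hm`
(`HermSpace3.isHermitian`, and `IsCMField.complexConj L = cmConjRingHom L` as ring maps). [folklore] -/
theorem transpose_map_complexConj_Hm {L : CMField} {ι₁ : L →+* ℂ} (V : HermSpace3 L ι₁) :
    (V.Hm.map (IsCMField.complexConj L : L →+* L))ᵀ = V.Hm := by
  refine Matrix.ext fun i j => ?_
  rw [Matrix.transpose_apply, Matrix.map_apply, coe_complexConj_eq_conjRingHomK']
  exact V.isHermitian j i

/-- **The body of B01-H at an anisotropic code.**  For `U = picardCMUniverse hHD hI h₁ h₃`, a level `Γ` whose Picard code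
is anisotropic, and non-zero `a, a' ∈ H^{1,0}(U.pms L ι₁ V Γ)`: there are a rational isometry `γ ∈ U(V₃,h)(L)` and the two
projections `T = π_γ`, `π` of the Hecke correspondence from the Hecke level `Γ.heckePair γ` with `T^* a ∪ π^* a' ≠ 0`.
The dense subgroup is the frame image of `U(V₃,h)(L)` (`BallRational.dense_ratSubgroup`); the wedge is
`UnitaryBallUniformisationDatum.exists_mem_forall_cup_pull_ne_zero`; the morphisms are `Model.exists_mor_pms_heckePair`.
[cite: Venkataramana2001, Thm. 8 and Remark, p. 229] [cite: Clozel1993ProduitsII, Introduction (théorème principal)] -/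
theorem heckeWedge10_body_of_isAnisotropic {L : CMField} {ι₁ : L →+* ℂ} {V : HermSpace3 L ι₁} (Γ : Level V)
    (h : (pmsCode L ι₁ V Γ).IsAnisotropic)
    (a a' : (picardCMUniverse hHD hI h₁ h₃).CohC ((picardCMUniverse hHD hI h₁ h₃).pms L ι₁ V Γ) 1)
    (ha : a ∈ ((picardCMUniverse hHD hI h₁ h₃).hodge ((picardCMUniverse hHD hI h₁ h₃).pms L ι₁ V Γ) 1).piece 1 0)
    (ha' : a' ∈ ((picardCMUniverse hHD hI h₁ h₃).hodge ((picardCMUniverse hHD hI h₁ h₃).pms L ι₁ V Γ) 1).piece 1 0)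
    (h0 : a ≠ 0) (h0' : a' ≠ 0) :
    ∃ (Γ' : Level V) (g h : (picardCMUniverse hHD hI h₁ h₃).Mor ((picardCMUniverse hHD hI h₁ h₃).pms L ι₁ V Γ')
        ((picardCMUniverse hHD hI h₁ h₃).pms L ι₁ V Γ)),
      (picardCMUniverse hHD hI h₁ h₃).cup2C ((picardCMUniverse hHD hI h₁ h₃).pms L ι₁ V Γ') 1
        ((picardCMUniverse hHD hI h₁ h₃).pullC g 1 a) ((picardCMUniverse hHD hI h₁ h₃).pullC h 1 a') ≠ 0 := by
  -- the ball datum of the realising surface and a Sylvester frame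
  set hU := ballQuotientUniformisedDatum_of h₁ with hUdef
  obtain ⟨𝔣⟩ := (Var.ballDatum hU h₃ (pmsCode L ι₁ V Γ) h).nonempty_sylvesterFrame
  have hT : (𝔣.T : Matrix (Fin 3) (Fin 3) ℂ)ᴴ * V.Hm.map ι₁ * (𝔣.T : Matrix (Fin 3) (Fin 3) ℂ) = BallModel.J := by
    rw [← ballDatum_Hℂ hU h₃ Γ h]
    exact 𝔣.conjTranspose_mul_mul
  -- the dense subgroup of rational isometries, read on the ball
  have hΔ : Dense ((BallRational.ratSubgroup L ι₁ V.Hm 𝔣.T hT : Subgroup U21) : Set U21) :=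
    BallRational.dense_ratSubgroup L ι₁ V.Hm 𝔣.T hT (transpose_map_complexConj_Hm V)
  -- `H^{1,0} ⊆ F¹`
  have haF : a ∈ (BettiUniverse.hodge hHD (Var.isSmoothProjective hU h₃ (.pms (pmsCode L ι₁ V Γ))) 1).F 1 :=
    HodgeStructure.piece_le_F _ 1 0 ha
  have haF' : a' ∈ (BettiUniverse.hodge hHD (Var.isSmoothProjective hU h₃ (.pms (pmsCode L ι₁ V Γ))) 1).F 1 :=
    HodgeStructure.piece_le_F _ 1 0 ha'
  -- the Hecke wedge of the ball quotient
  obtain ⟨ĝ, hĝΔ, hmain⟩ := (Var.ballDatum hU h₃ (pmsCode L ι₁ V Γ) h).exists_mem_forall_cup_pull_ne_zero hHD hI 𝔣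
    (BallRational.ratSubgroup L ι₁ V.Hm 𝔣.T hT) hΔ haF haF' h0 h0'
  obtain ⟨γ, hγĝ⟩ := MonoidHom.mem_range.1 hĝΔ
  have hγ : (γ : GL (Fin 3) L) ∈ unitaryGroup (cmConjRingHom L) V.Hm := by
    rw [← coe_complexConj_eq_conjRingHomK']
    exact γ.2
  -- the two projections of the Hecke correspondence from the Hecke level
  obtain ⟨π, T, hπT⟩ := exists_mor_pms_heckePair hHD hI h₁ h₃ Γ hγ h
  refine ⟨Γ.heckePair (γ : GL (Fin 3) L) hγ, T, π, ?_⟩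
  -- the ball datum of the Hecke level: same hermitian space, same frame matrix
  have h' : (pmsCode L ι₁ V (Γ.heckePair (γ : GL (Fin 3) L) hγ)).IsAnisotropic :=
    (isAnisotropic_pmsCode_iff_of_level Γ (Γ.heckePair (γ : GL (Fin 3) L) hγ)).2 h
  have hH : (Var.ballDatum hU h₃ (pmsCode L ι₁ V (Γ.heckePair (γ : GL (Fin 3) L) hγ)) h').Hℂ =
      (Var.ballDatum hU h₃ (pmsCode L ι₁ V Γ) h).Hℂ := by
    rw [ballDatum_Hℂ hU h₃ _ h', ballDatum_Hℂ hU h₃ _ h]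
  let 𝔣' : (Var.ballDatum hU h₃ (pmsCode L ι₁ V (Γ.heckePair (γ : GL (Fin 3) L) hγ)) h').SylvesterFrame :=
    ⟨𝔣.T, by rw [hH]; exact 𝔣.conjTranspose_mul_mul⟩
  -- `γ^{ι₁} ∈ U(H^{τ₁})`, and its frame image is the ball element `ĝ`
  have hg : Matrix.GeneralLinearGroup.map ι₁ (γ : GL (Fin 3) L) ∈ (Var.ballDatum hU h₃ (pmsCode L ι₁ V Γ) h).realPoints :=
    map_ι₁_mem_realPoints_ballDatum hU h₃ Γ h hγ
  have hfr : (Var.ballDatum hU h₃ (pmsCode L ι₁ V Γ) h).frameIso 𝔣 ⟨_, hg⟩ = ĝ := by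
    rw [← hγĝ]
    apply Subtype.ext
    apply Units.ext
    change BallModel.mat ((Var.ballDatum hU h₃ (pmsCode L ι₁ V Γ) h).frameIso 𝔣 ⟨_, hg⟩) =
      BallModel.mat (BallRational.toBall L ι₁ V.Hm 𝔣.T hT γ)
    rw [UnitaryBallUniformisationDatum.mat_frameIso, BallRational.mat_toBall]
    rfl
  exact hmain _ 𝔣' rfl hg hfr T π (fun v hv ↦ (hπT v hv).2) (fun v hv ↦ (hπT v hv).1)

/-- **B01-H holds on the model universe**: `(picardCMUniverse hHD hI h₁ h₃).HeckeWedge10` for all data — the displayed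
input `hW` of `Model.perLFace_of_PerL_of_supply_heckeWedge10_overlap` is a theorem (anisotropic codes:
`heckeWedge10_body_of_isAnisotropic`; other codes: `H¹(ℙ²) = 0`, b28's `picardCMUniverse_heckeWedge10_of_isAnisotropic`).
[cite: Venkataramana2001, Thm. 8 and Remark, p. 229] [cite: Clozel1993ProduitsII, Introduction (théorème principal)] -/
theorem heckeWedge10_holds : (picardCMUniverse hHD hI h₁ h₃).HeckeWedge10 :=
  picardCMUniverse_heckeWedge10_of_isAnisotropic hHD hI h₃ h₁ fun _L _ι₁ _V Γ h a a' ha ha' h0 h0' ↦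
    heckeWedge10_body_of_isAnisotropic hHD hI h₁ h₃ Γ h a a' ha ha' h0 h0'

/-- **B01 BY NAME from supply and overlap alone** (B01-H discharged): `PerLFace_of_PerL` follows from
`(∀ data, FaceSupply)` and `(∀ data, FaceWedgeOverlap)` — `Model.perLFace_of_PerL_of_supply_heckeWedge10_overlap` with its middle
input supplied by `heckeWedge10_holds`.  `U.PerL` idle, as before. [folklore] -/
theorem perLFace_of_PerL_of_supply_overlap
    (hS : ∀ (hHD : exists_isReal_hodgeModel) (hI : hodgePQ_independent_of_hodgeModel)
      (h₁ : BallQuotientUniformised) (h₃ : CMAbelianVarietyRealised), (picardCMUniverse hHD hI h₁ h₃).FaceSupply)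
    (hO : ∀ (hHD : exists_isReal_hodgeModel) (hI : hodgePQ_independent_of_hodgeModel)
      (h₁ : BallQuotientUniformised) (h₃ : CMAbelianVarietyRealised), (picardCMUniverse hHD hI h₁ h₃).FaceWedgeOverlap) :
    PerLFace_of_PerL :=
  perLFace_of_PerL_of_supply_heckeWedge10_overlap hS (fun hHD hI h₁ h₃ ↦ heckeWedge10_holds hHD hI h₁ h₃) hO

/-- The closed instance on the model universe OF RECORD: `PerLFace` (= F3's hypothesis) from `FaceSupply` and
`FaceWedgeOverlap` of that universe. [folklore] -/
theorem perLFace_closed_of_supply_overlap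
    (hS : (picardCMUniverse exists_isReal_hodgeModel_holds hodgePQ_independent_of_hodgeModel_holds
      BallQuotient.ballQuotientUniformised_holds cmAbelianVarietyRealised_holds).FaceSupply)
    (hO : (picardCMUniverse exists_isReal_hodgeModel_holds hodgePQ_independent_of_hodgeModel_holds
      BallQuotient.ballQuotientUniformised_holds cmAbelianVarietyRealised_holds).FaceWedgeOverlap) :
    (picardCMUniverse exists_isReal_hodgeModel_holds hodgePQ_independent_of_hodgeModel_holds
      BallQuotient.ballQuotientUniformised_holds cmAbelianVarietyRealised_holds).PerLFace :=
  perLFace_closed_of_supply_heckeWedge10_overlap hS (heckeWedge10_holds _ _ _ _) hO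

end Summit.HodgeConjecture.CorCM.Model

end
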